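/-
Copyright (c) 2026. All rights reserved.
Released under Apache 2.0 license as described in the file LICENSE.
-/
import Summits.Langlands.Langlands.Theorems.SoloInformedResidueFieldC
import Literature.NumberTheory.PAdicHodge.BmaxPlus
import HarnessLib

/-!
# The unramified specialisation `λ : B_max⁺(F) → W(k_C)`

Solo/informed seat, programme Λ (statement repair D2-cris, input (I2), untwisted layer
`(A_max)^{Γ_F} = W(k_F)`): file Λ1b.  With `k_C = 𝒪_{ℂ_F}/𝔪_C` and `W(π) : 𝔸_inf(F) → W(k_C)` from
`SoloInformedResidueFieldC` (`W(π)(ξ) = -p`), we construct — exactly along the pattern of Fontaine's `θ` on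
`B_max⁺` in `Literature/.../BmaxPlusTheta` — the ring homomorphism

  `λ = specBmaxPlus : B_max⁺(F) = (B⁰_max)^_(p) → W(k_C)`:

* §1 `W(π)[1/p]` on `𝔸_inf[1/p]` (`ainfResidueLoc`) takes the value `-1` at `ξ/p` (`ainfResidueLoc_xiDivP`), hence
  integral values on `B⁰_max = 𝔸_inf[ξ/p]` (`ainfResidueLoc_mem_range_of_mem`); its restriction
  `λ⁰ = specBmaxZero : B⁰_max → W(k_C)` (`specBmaxZero_algebraMap : λ⁰|_{𝔸_inf} = W(π)`, `λ⁰(p) = p`).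
* §2 `λ⁰` is `Γ_F`-equivariant (`specBmaxZero_galBmaxZero`), by comparison inside `W(k_C)[1/p]`.
* §3 `λ = specBmaxPlus`: the `p`-adically continuous extension (`W(k_C)` is `p`-adically complete, Mathlib
  `WittVector.isAdicCompleteIdealSpanP`), with `specBmaxPlus_of`, **`specBmaxPlus_ainfToBmaxPlus : λ ∘ (𝔸_inf → A_max) = W(π)`**,
  the level formula `mk_pow_specBmaxPlus`, and **`specBmaxPlus_ainfToBmaxPlus_wittToAinf : λ ∘ ι = W(j)`** for
  `ι : W(k̄) → 𝔸_inf → A_max`, `j : k̄ → k_C`.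
* §4 **`λ` is `Γ_F`-equivariant** (`specBmaxPlus_galBmaxPlus : λ (σ x) = 𝕎(σ̄_C) (λ x)`), from §2 and the level
  formula (`W(k_C)` is `p`-adically separated).

Why `λ` and not `θ`: `θ` restricted to `(A_max)^{Γ_F}` hits the RAMIFIED ring `𝒪_F`, while `λ` lands in the
unramified `W(k_C)`, where `W(k̄)` is integrally closed for Witt-polynomial relations
(`SoloInformedWittIntegralRange`); file Λ2 concludes `(A_max)^{Γ_F} = ι(W(k̄))^{Γ_F} = W(k_F)`.

References: Fontaine, Astérisque 223 (1994), Exp. II §1.2; Colmez, Ann. of Math. 148 (1998), §III.2;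
Berger, Invent. Math. 148 (2002), §1.2.
-/

noncomputable section

open WittVector Field IsLocalRing ValuativeRel
open Literature.AlgebraicGeometry.Resolution
open Literature.NumberTheory.GaloisRepresentations Literature.NumberTheory.PAdicHodge
open Literature.NumberTheory.GaloisRepresentations.IsNonarchimedeanLocalField

namespace Summit.Langlands.Langlands.Theorems

namespace SpecC

variable {F : Type} [Field F] [ValuativeRel F] [TopologicalSpace F] [IsNonarchimedeanLocalField F]
  {p : ℕ} [Fact p.Prime] [Fact (¬ IsUnit (p : integerC F))] [CharP (ResidueField (integerC F)) p]

/-! ### §1 `W(π)[1/p]` and `λ⁰ : B⁰_max → W(k_C)` -/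

omit [CharP (ResidueField (integerC F)) p] in
/-- `W(π)` maps the powers of `p` into themselves. [folklore] -/
theorem powers_le_comap_ainfResidue :
    Submonoid.powers (p : Ainf (p := p) F) ≤
      (Submonoid.powers (p : WittVector p (ResidueField (integerC F)))).comap (ainfResidue F p) := by
  rintro _ ⟨n, rfl⟩
  exact ⟨n, by rw [map_pow, map_natCast]⟩

variable (F p) in
/-- **`W(π)[1/p] : 𝔸_inf[1/p] → W(k_C)[1/p]`** (functoriality of localizations). [cite: FontaineAsterisque223III, Exp. II §1.2] -/
def ainfResidueLoc : Localization.Away (p : Ainf (p := p) F) →+*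
    Localization.Away (p : WittVector p (ResidueField (integerC F))) :=
  IsLocalization.map (M := Submonoid.powers (p : Ainf (p := p) F))
    (T := Submonoid.powers (p : WittVector p (ResidueField (integerC F))))
    (Localization.Away (p : WittVector p (ResidueField (integerC F)))) (ainfResidue F p) powers_le_comap_ainfResidue

omit [CharP (ResidueField (integerC F)) p] in
/-- `W(π)[1/p]` extends `W(π)`. [folklore] -/
@[simp] theorem ainfResidueLoc_algebraMap (x : Ainf (p := p) F) :
    ainfResidueLoc F p (algebraMap (Ainf (p := p) F) (Localization.Away (p : Ainf (p := p) F)) x) =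
      algebraMap (WittVector p (ResidueField (integerC F)))
        (Localization.Away (p : WittVector p (ResidueField (integerC F)))) (ainfResidue F p x) :=
  IsLocalization.map_eq _ _

omit [CharP (ResidueField (integerC F)) p] in
/-- **`W(π)[1/p](ξ/p) = -1`** (`p · W(π)[1/p](ξ/p) = W(π)(ξ) = -p` and `p` is a unit of `W(k_C)[1/p]`).
[cite: FontaineAsterisque223III, Exp. II §1.2.2] -/
theorem ainfResidueLoc_xiDivP : ainfResidueLoc F p (xiDivP F p) = -1 := by
  have h := congrArg (ainfResidueLoc F p) (algebraMap_natCast_mul_xiDivP (F := F) (p := p))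
  rw [map_mul, ainfResidueLoc_algebraMap, ainfResidueLoc_algebraMap, ainfResidue_xi, map_natCast (ainfResidue F p),
    map_neg, map_natCast (algebraMap (WittVector p (ResidueField (integerC F)))
      (Localization.Away (p : WittVector p (ResidueField (integerC F)))))] at h
  have hu := IsLocalization.Away.algebraMap_isUnit
    (S := Localization.Away (p : WittVector p (ResidueField (integerC F)))) (p : WittVector p (ResidueField (integerC F)))
  rw [map_natCast] at hu
  exact hu.mul_left_cancel (h.trans (mul_neg_one _).symm)

omit [CharP (ResidueField (integerC F)) p] in
/-- **`W(π)[1/p](B⁰_max) ⊆ W(k_C)`**: the values of `W(π)[1/p]` on `B⁰_max = 𝔸_inf[ξ/p]` are integral.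
[cite: FontaineAsterisque223III, Exp. II §1.2] -/
theorem ainfResidueLoc_mem_range_of_mem {x : Localization.Away (p : Ainf (p := p) F)} (hx : x ∈ bmaxZero F p) :
    ainfResidueLoc F p x ∈ (algebraMap (WittVector p (ResidueField (integerC F)))
      (Localization.Away (p : WittVector p (ResidueField (integerC F))))).range := by
  refine Algebra.adjoin_induction (fun y hy => ?_) (fun r => ?_) (fun y z _ _ hy hz => ?_) (fun y z _ _ hy hz => ?_) hx
  · rw [Set.mem_singleton_iff.1 hy, ainfResidueLoc_xiDivP]
    exact neg_mem (one_mem _)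
  · rw [ainfResidueLoc_algebraMap]
    exact ⟨_, rfl⟩
  · rw [map_add]; exact add_mem hy hz
  · rw [map_mul]; exact mul_mem hy hz

omit [Fact (¬ IsUnit (p : integerC F))] in
/-- **`W(k_C) → W(k_C)[1/p]` is injective** (`W(k_C)` is a domain in which `p ≠ 0`). [folklore] -/
theorem algebraMap_witt_away_injective :
    Function.Injective (algebraMap (WittVector p (ResidueField (integerC F)))
      (Localization.Away (p : WittVector p (ResidueField (integerC F))))) :=
  IsLocalization.injective (Localization.Away (p : WittVector p (ResidueField (integerC F))))
    (powers_le_nonZeroDivisors_of_noZeroDivisors (WittVector.p_nonzero p (ResidueField (integerC F))))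

omit [CharP (ResidueField (integerC F)) p] in
/-- The value `W(π)[1/p](x) ∈ W(k_C)` for `x ∈ B⁰_max`, as an existence statement. [folklore] -/
theorem exists_algebraMap_eq_ainfResidueLoc (x : bmaxZero F p) :
    ∃ c : WittVector p (ResidueField (integerC F)),
      algebraMap (WittVector p (ResidueField (integerC F)))
        (Localization.Away (p : WittVector p (ResidueField (integerC F)))) c =
      ainfResidueLoc F p (x : Localization.Away (p : Ainf (p := p) F)) :=
  RingHom.mem_range.1 (ainfResidueLoc_mem_range_of_mem x.2)

variable (F p) in
/-- **`λ⁰ : B⁰_max → W(k_C)`**, the restriction of `W(π)[1/p]` (integral on `B⁰_max`). [cite: FontaineAsterisque223III, Exp. II §1.2] -/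
def specBmaxZero : bmaxZero F p →+* WittVector p (ResidueField (integerC F)) where
  toFun x := Classical.choose (exists_algebraMap_eq_ainfResidueLoc x)
  map_one' := algebraMap_witt_away_injective (by
    rw [Classical.choose_spec (exists_algebraMap_eq_ainfResidueLoc (1 : bmaxZero F p)), map_one,
      Subalgebra.coe_one, map_one])
  map_mul' x y := algebraMap_witt_away_injective (by
    rw [Classical.choose_spec (exists_algebraMap_eq_ainfResidueLoc (x * y)), map_mul,
      Classical.choose_spec (exists_algebraMap_eq_ainfResidueLoc x),
      Classical.choose_spec (exists_algebraMap_eq_ainfResidueLoc y), Subalgebra.coe_mul, map_mul])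
  map_zero' := algebraMap_witt_away_injective (by
    rw [Classical.choose_spec (exists_algebraMap_eq_ainfResidueLoc (0 : bmaxZero F p)), map_zero,
      Subalgebra.coe_zero, map_zero])
  map_add' x y := algebraMap_witt_away_injective (by
    rw [Classical.choose_spec (exists_algebraMap_eq_ainfResidueLoc (x + y)), map_add,
      Classical.choose_spec (exists_algebraMap_eq_ainfResidueLoc x),
      Classical.choose_spec (exists_algebraMap_eq_ainfResidueLoc y), Subalgebra.coe_add, map_add])

/-- **`λ⁰` is `W(π)[1/p]` restricted to `B⁰_max`.** [cite: FontaineAsterisque223III, Exp. II §1.2] -/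
theorem algebraMap_specBmaxZero (x : bmaxZero F p) :
    algebraMap (WittVector p (ResidueField (integerC F)))
        (Localization.Away (p : WittVector p (ResidueField (integerC F)))) (specBmaxZero F p x) =
      ainfResidueLoc F p (x : Localization.Away (p : Ainf (p := p) F)) :=
  Classical.choose_spec (exists_algebraMap_eq_ainfResidueLoc x)

/-- **`λ⁰ ∘ (𝔸_inf → B⁰_max) = W(π)`.** [cite: FontaineAsterisque223III, Exp. II §1.2] -/
theorem specBmaxZero_algebraMap (a : Ainf (p := p) F) :
    specBmaxZero F p (algebraMap (Ainf (p := p) F) (bmaxZero F p) a) = ainfResidue F p a :=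
  algebraMap_witt_away_injective (by
    rw [algebraMap_specBmaxZero, coe_algebraMap_bmaxZero, ainfResidueLoc_algebraMap])

/-- **`λ⁰(ξ/p) = -1`.** [cite: FontaineAsterisque223III, Exp. II §1.2.2] -/
theorem specBmaxZero_xiDivP (h : xiDivP F p ∈ bmaxZero F p) : specBmaxZero F p ⟨xiDivP F p, h⟩ = -1 :=
  algebraMap_witt_away_injective (by rw [algebraMap_specBmaxZero, ainfResidueLoc_xiDivP, map_neg, map_one])

/-- `λ⁰(p) = p`. [folklore] -/
theorem specBmaxZero_natCast (n : ℕ) : specBmaxZero F p (n : bmaxZero F p) = n := map_natCast _ n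

/-- `λ⁰` maps the ideal `(p)` of `B⁰_max` into `(p) ⊆ W(k_C)`. [folklore] -/
theorem map_specBmaxZero_span_le :
    (Ideal.span {(p : bmaxZero F p)}).map (specBmaxZero F p) ≤ Ideal.span {(p : WittVector p (ResidueField (integerC F)))} := by
  rw [Ideal.map_span, Set.image_singleton, specBmaxZero_natCast]

/-! ### §2 `λ⁰` is `Γ_F`-equivariant -/

omit [Fact (¬ IsUnit (p : integerC F))] [CharP (ResidueField (integerC F)) p] in
/-- `𝕎(σ̄_C)` maps the powers of `p` into themselves. [folklore] -/
theorem powers_le_comap_map_galResidueC (σ : absoluteGaloisGroup F) :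
    Submonoid.powers (p : WittVector p (ResidueField (integerC F))) ≤
      (Submonoid.powers (p : WittVector p (ResidueField (integerC F)))).comap (WittVector.map (galResidueC σ)) := by
  rintro _ ⟨n, rfl⟩
  exact ⟨n, by rw [map_pow, map_natCast]⟩

/-- **`𝕎(σ̄_C)[1/p]` on `W(k_C)[1/p]`.** [folklore] -/
def galResidueCLoc (σ : absoluteGaloisGroup F) :
    Localization.Away (p : WittVector p (ResidueField (integerC F))) →+*
      Localization.Away (p : WittVector p (ResidueField (integerC F))) :=
  IsLocalization.map (M := Submonoid.powers (p : WittVector p (ResidueField (integerC F))))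
    (T := Submonoid.powers (p : WittVector p (ResidueField (integerC F))))
    (Localization.Away (p : WittVector p (ResidueField (integerC F)))) (WittVector.map (galResidueC σ))
    (powers_le_comap_map_galResidueC σ)

omit [Fact (¬ IsUnit (p : integerC F))] [CharP (ResidueField (integerC F)) p] in
/-- `𝕎(σ̄_C)[1/p]` extends `𝕎(σ̄_C)`. [folklore] -/
@[simp] theorem galResidueCLoc_algebraMap (σ : absoluteGaloisGroup F) (x : WittVector p (ResidueField (integerC F))) :
    galResidueCLoc (F := F) σ (algebraMap _ (Localization.Away (p : WittVector p (ResidueField (integerC F)))) x) =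
      algebraMap _ (Localization.Away (p : WittVector p (ResidueField (integerC F)))) (WittVector.map (galResidueC σ) x) :=
  IsLocalization.map_eq _ _

section Galois

variable [CharZero F] [IsAdicComplete (Ideal.span {(p : integerC F)}) (integerC F)]

omit [CharP (ResidueField (integerC F)) p] [CharZero F] [IsAdicComplete (Ideal.span {(p : integerC F)}) (integerC F)] in
/-- **`W(π)[1/p]` is `Γ_F`-equivariant**: `W(π)[1/p] ∘ 𝕎(σ♭)[1/p] = 𝕎(σ̄_C)[1/p] ∘ W(π)[1/p]`. [cite: FontaineAsterisque223III, Exp. II §1.2] -/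
theorem ainfResidueLoc_galAinfLoc (σ : absoluteGaloisGroup F) (x : Localization.Away (p : Ainf (p := p) F)) :
    ainfResidueLoc F p (galAinfLoc σ x) = galResidueCLoc (F := F) σ (ainfResidueLoc F p x) := by
  have h : (ainfResidueLoc F p).comp (galAinfLoc σ) = (galResidueCLoc (F := F) (p := p) σ).comp (ainfResidueLoc F p) := by
    refine IsLocalization.ringHom_ext (Submonoid.powers (p : Ainf (p := p) F)) (RingHom.ext fun y => ?_)
    rw [RingHom.comp_apply, RingHom.comp_apply, galAinfLoc_algebraMap, ainfResidueLoc_algebraMap, ainfResidue_galAinf,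
      RingHom.comp_apply, RingHom.comp_apply, ainfResidueLoc_algebraMap, galResidueCLoc_algebraMap]
  exact RingHom.congr_fun h x

/-- **`λ⁰` is `Γ_F`-equivariant**: `λ⁰ (σ y) = 𝕎(σ̄_C) (λ⁰ y)`. [cite: FontaineAsterisque223III, Exp. II §1.2] -/
theorem specBmaxZero_galBmaxZero (σ : absoluteGaloisGroup F) (y : bmaxZero F p) :
    specBmaxZero F p (galBmaxZero σ y) = WittVector.map (galResidueC σ) (specBmaxZero F p y) :=
  algebraMap_witt_away_injective (by
    rw [algebraMap_specBmaxZero, coe_galBmaxZero, ainfResidueLoc_galAinfLoc, ← galResidueCLoc_algebraMap,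
      algebraMap_specBmaxZero])

end Galois

/-! ### §3 `λ : B_max⁺(F) → W(k_C)` -/

variable [CharZero F]

variable (F p) in
/-- **The unramified specialisation `λ : A_max = B_max⁺(F) → W(k_C)`**, the `p`-adically continuous extension of `λ⁰`
(adic-completion functoriality composed with `W(k_C) ≅ W(k_C)^_(p)`). [cite: FontaineAsterisque223III, Exp. II §1.2] -/
def specBmaxPlus : BmaxPlus F p →+* WittVector p (ResidueField (integerC F)) where
  toFun x := (AdicCompletion.ofAlgEquiv (Ideal.span {(p : WittVector p (ResidueField (integerC F)))})).symm
    (adicCompletionMap (Ideal.span {(p : bmaxZero F p)}) (Ideal.span {(p : WittVector p (ResidueField (integerC F)))})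
      (specBmaxZero F p) map_specBmaxZero_span_le x)
  map_one' := by simp only [map_one]
  map_mul' x y := by simp only [map_mul]
  map_zero' := by simp only [map_zero]
  map_add' x y := by simp only [map_add]

/-- Unfolding of `λ`. [folklore] -/
theorem specBmaxPlus_apply (x : BmaxPlus F p) :
    specBmaxPlus F p x = (AdicCompletion.ofAlgEquiv (Ideal.span {(p : WittVector p (ResidueField (integerC F)))})).symm
      (adicCompletionMap (Ideal.span {(p : bmaxZero F p)}) (Ideal.span {(p : WittVector p (ResidueField (integerC F)))})
        (specBmaxZero F p) map_specBmaxZero_span_le x) := rfl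

set_option maxHeartbeats 1600000 in
/-- **`λ` extends `λ⁰`.** [cite: FontaineAsterisque223III, Exp. II §1.2] -/
theorem specBmaxPlus_of (y : bmaxZero F p) :
    specBmaxPlus F p (AdicCompletion.of (Ideal.span {(p : bmaxZero F p)}) (bmaxZero F p) y) = specBmaxZero F p y := by
  rw [specBmaxPlus_apply, adicCompletionMap_of, AdicCompletion.ofAlgEquiv_symm_of]

set_option maxHeartbeats 1600000 in
/-- `λ` on the image of `B⁰_max` (algebra-map form). [folklore] -/
theorem specBmaxPlus_algebraMap (y : bmaxZero F p) :
    specBmaxPlus F p (algebraMap (bmaxZero F p) (BmaxPlus F p) y) = specBmaxZero F p y :=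
  specBmaxPlus_of y

set_option maxHeartbeats 1600000 in
/-- **`λ ∘ (𝔸_inf → A_max) = W(π)`.** [cite: FontaineAsterisque223III, Exp. II §1.2] -/
theorem specBmaxPlus_ainfToBmaxPlus (a : Ainf (p := p) F) :
    specBmaxPlus F p (ainfToBmaxPlus F p a) = ainfResidue F p a := by
  rw [ainfToBmaxPlus_apply, specBmaxPlus_of, specBmaxZero_algebraMap]

set_option maxHeartbeats 1600000 in
/-- **Level formula: `λ(x) mod pⁿ = λ̄⁰(x mod pⁿ)`.** [cite: FontaineAsterisque223III, Exp. II §1.2] -/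
theorem mk_pow_specBmaxPlus (n : ℕ) (x : BmaxPlus F p) :
    Ideal.Quotient.mk (Ideal.span {(p : WittVector p (ResidueField (integerC F)))} ^ n) (specBmaxPlus F p x) =
      Ideal.quotientMap (Ideal.span {(p : WittVector p (ResidueField (integerC F)))} ^ n) (specBmaxZero F p)
        (pow_le_comap_pow_of_map_le (specBmaxZero F p) map_specBmaxZero_span_le n)
        (AdicCompletion.evalₐ (Ideal.span {(p : bmaxZero F p)}) n x) := by
  rw [specBmaxPlus_apply, AdicCompletion.mk_ofAlgEquiv_symm, evalₐ_adicCompletionMap]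

set_option maxHeartbeats 1600000 in
/-- **`λ(x) ≡ λ⁰(y) (mod pⁿ)` whenever `x ≡ y (mod pⁿ)`**, `y ∈ B⁰_max`. [folklore] -/
theorem specBmaxPlus_sub_mem_of_evalₐ_eq {n : ℕ} {x : BmaxPlus F p} {y : bmaxZero F p}
    (hx : AdicCompletion.evalₐ (Ideal.span {(p : bmaxZero F p)}) n x = Ideal.Quotient.mk _ y) :
    specBmaxPlus F p x - specBmaxZero F p y ∈ Ideal.span {(p : WittVector p (ResidueField (integerC F)))} ^ n := by
  rw [← Ideal.Quotient.eq, mk_pow_specBmaxPlus, hx, Ideal.quotientMap_mk]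

set_option maxHeartbeats 1600000 in
/-- **`λ ∘ ι = W(j)`** for `ι : W(k̄) → 𝔸_inf(F) → A_max` and `j : k̄ → k_C`: the specialisation of an unramified Witt
vector is the Witt vector of the specialised coefficients. [cite: FontaineAsterisque223III, Exp. II §1.2] -/
theorem specBmaxPlus_ainfToBmaxPlus_wittToAinf [Fact (¬ IsUnit (p : maxUnramifiedCompletion F))]
    [CharP (ResidueField (maxUnramifiedCompletion F)) p] (z : WittVector p (ResidueField (maxUnramifiedCompletion F))) :
    specBmaxPlus F p (ainfToBmaxPlus F p (wittToAinf F p z)) = WittVector.map (residueToResidueC F p) z := by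
  rw [specBmaxPlus_ainfToBmaxPlus, ainfResidue_wittToAinf]

/-! ### §4 `λ` is `Γ_F`-equivariant -/

section GaloisPlus

variable [IsAdicComplete (Ideal.span {(p : integerC F)}) (integerC F)]

omit [CharP (ResidueField (integerC F)) p] in
set_option maxHeartbeats 1600000 in
/-- Level formula for the `Γ_F`-action on `B_max⁺`: `(σ x) mod pⁿ = σ̄ (x mod pⁿ)`. [cite: BergerLaurent2002, §1.2] -/
theorem evalₐ_galBmaxPlus (σ : absoluteGaloisGroup F) (n : ℕ) (x : BmaxPlus F p) :
    AdicCompletion.evalₐ (Ideal.span {(p : bmaxZero F p)}) n (galBmaxPlus σ x) =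
      Ideal.quotientMap (Ideal.span {(p : bmaxZero F p)} ^ n) (galBmaxZero (F := F) (p := p) σ)
        (pow_le_comap_pow_of_map_le (galBmaxZero (F := F) (p := p) σ) (map_galBmaxZero_span_le (F := F) (p := p) σ) n)
        (AdicCompletion.evalₐ (Ideal.span {(p : bmaxZero F p)}) n x) := by
  unfold galBmaxPlus
  exact evalₐ_adicCompletionMap _ _ _ _ n x

set_option maxHeartbeats 1600000 in
/-- **`λ` is `Γ_F`-equivariant**: `λ (σ x) = 𝕎(σ̄_C) (λ x)` for `x ∈ B_max⁺(F)`, `σ ∈ Γ_F` (from the equivariance of `λ⁰`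
level by level; `W(k_C)` is `p`-adically separated). [cite: FontaineAsterisque223III, Exp. II §1.2] -/
theorem specBmaxPlus_galBmaxPlus (σ : absoluteGaloisGroup F) (x : BmaxPlus F p) :
    specBmaxPlus F p (galBmaxPlus σ x) = WittVector.map (galResidueC σ) (specBmaxPlus F p x) := by
  rw [← sub_eq_zero]
  refine eq_zero_of_forall_mem_span_pow_witt (F := F) fun n => ?_
  obtain ⟨y, hy⟩ := Ideal.Quotient.mk_surjective (AdicCompletion.evalₐ (Ideal.span {(p : bmaxZero F p)}) n x)
  have h1 : AdicCompletion.evalₐ (Ideal.span {(p : bmaxZero F p)}) n (galBmaxPlus σ x) =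
      Ideal.Quotient.mk _ (galBmaxZero σ y) := by
    rw [evalₐ_galBmaxPlus, ← hy, Ideal.quotientMap_mk]
  have h2 := specBmaxPlus_sub_mem_of_evalₐ_eq h1
  rw [specBmaxZero_galBmaxZero] at h2
  have h3 : WittVector.map (galResidueC σ) (specBmaxPlus F p x) -
      WittVector.map (galResidueC σ) (specBmaxZero F p y) ∈
        Ideal.span {(p : WittVector p (ResidueField (integerC F)))} ^ n := by
    rw [← map_sub]
    exact map_mem_span_natCast_pow (WittVector.map (galResidueC σ)) n (specBmaxPlus_sub_mem_of_evalₐ_eq hy.symm)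
  have h4 := sub_mem h2 h3
  rwa [sub_sub_sub_cancel_right] at h4

/-- The same for the `MulSemiringAction`: `λ (σ • x) = 𝕎(σ̄_C) (λ x)`. [folklore] -/
theorem specBmaxPlus_smul (σ : absoluteGaloisGroup F) (x : BmaxPlus F p) :
    specBmaxPlus F p (σ • x) = WittVector.map (galResidueC σ) (specBmaxPlus F p x) := by
  rw [smul_bmaxPlus_def, specBmaxPlus_galBmaxPlus]

/-- **`λ` of a `Γ_F`-invariant element is `Γ_F`-invariant.** [folklore] -/
theorem map_galResidueC_specBmaxPlus_of_forall (x : BmaxPlus F p) (hx : ∀ σ : absoluteGaloisGroup F, galBmaxPlus σ x = x)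
    (σ : absoluteGaloisGroup F) :
    WittVector.map (galResidueC σ) (specBmaxPlus F p x) = specBmaxPlus F p x := by
  rw [← specBmaxPlus_galBmaxPlus, hx σ]

end GaloisPlus

end SpecC

end Summit.Langlands.Langlands.Theorems

end
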